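import Summits.ABC.StewartYu.GenThreeInductionOdd
import Summits.ABC.StewartYu.GenThreeStepTwo
import Summits.ABC.StewartYu.KummerBasisChangeSaturatedPM
import Summits.ABC.StewartYu.MatveevStepData
import HarnessLib

/-!
# Cell abc-stewartyu, Gen-3 frame at odd `p` (crux `Y07Odd`, stmt-ABC-19658): the MATVEEV STEP from the
# zero estimate's exit C to the second branch of the dichotomy — every shape hypothesis discharged

`Summits/ABC/StewartYu/GenThreeStepOdd.lean` — cell `abc-stewartyu` (HOME `run/shared/lean/pub/abc-stewartyu/`),
route `PadicPrimesKummerThird`, seat p4 (g3), engine-support seat; the odd-`p` TWIN of p3-g5's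
`Summits/ABC/StewartYu/GenThreeStepTwo.lean` (`q = 2` with signs for `q = 3`; units for principal units
`≡ 1 (mod 8)`).  Theorems only (composition of landed bricks); no definition, no named fact.

After the frame's extrapolation and the zero estimate (`GenThreeEndRat.exists_obstruction_rat` →
`ZeroEnd.zeroEnd`), exit C of Nesterenko's §5.2 hands the obstruction subgroup `H` with a `ℤ`-basis `M` of
`Φ = H.chars` (`r` independent rows, `0 < r < n`) and `b ∈ span_ℚ(rows M)`.  From this datum
`Summit.ABC.StewartYu.MatveevStepData.exists_matveev_step_data` (with `q = 2`) produces the re-based basis `Z`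
of `Φ`, the relation `m₀ b = ∑ mᵢ Zᵢ` and the Cramer–Hadamard bounds.  THIS FILE turns that output into the
rank-`r` datum of the internal statement `GenThreeInductionOdd.CoreOdd C p r` — the new generators
`θᵢ = ∏ⱼ αⱼ^{Zᵢⱼ}` with weights `Aᵢ := ‖Zᵢ‖_V = ∑ⱼ Vⱼ|Zᵢⱼ|` — and DISCHARGES every shape hypothesis:

* `θᵢ` are `p`-adic units (`GenThreeInductionOdd.unit_prod_zpow`);
* multiplicative independence and the SIGNED `2`-Kummer condition (`Φ` is saturated:
  `KummerBasisChange.kummerPM_basisChange` of `KummerBasisChangeSaturatedPM.lean` — the ± twin);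
* `h(θᵢ) ≤ Aᵢ`, `1 ≤ Aᵢ` (p3's `GenThreeStepTwo.logHeight₁_prod_zpow_le` / `one_le_weightedNorm`);
* `m ≠ 0` and the algebraic relation `∏ θᵢ^{mᵢ} = (∏ αⱼ^{bⱼ})^{m₀}`, `m₀ ≠ 0`;
* the size data: `∏ Aᵢ ≤ P(κ) := (r!)²·nʳ·|det M_κ|·∏ᵢ V_{κ i}` for a non-singular maximal weighted minor
  `κ`, `|m₀|·∏ V_κ′ ≤ ∏ Aᵢ`, `|mⱼ|·∏ V_κ′ ≤ (∑ᵢ V_κ′ᵢ|b_κ′ᵢ|)·∏_{i≠j} Aᵢ.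

`exists_step_generators` is that package.  `stepOdd_of_exitC` then closes `GenThreeInductionOdd.StepOdd` with
the canonical choices `A′max := P(κ)`, `W′ := W + log 3 + log n + log Vmax + log P(κ)` against ONE numeric
hypothesis on the record's side, uniformly in the minor `κ`:
`C(r)·P(κ)·(W′ + log p + log 2P(κ)) ≤ C(n)·∏V·(W + log p + log 2Vmax)` — Nesterenko's (5.22) line (the record
bounds `|det M_κ|` by the zero estimate's `nesterenkoH` inequality).  So, with `GenThreeInductionOdd{,Engine}`,
the registered stub `stub_engineOdd` is: extrapolation (5.4) at rank `n` under the negated bound + the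
record's exits A/B + this (5.22) line, at every odd prime.

WHAT THIS IS NOT: no analytic content, no numerics; no crux moves.

References: Yu. V. Nesterenko, LNM 1819 (2003), Prop. 2.6 (2.9)–(2.13), §5.2 (5.22); K. Yu, Forum Math. 19
(2007); K. Yu, Acta Math. 211 (2013), §2, §5.
-/

noncomputable section

open Finset
open Literature.NumberTheory.Transcendental
open Literature.NumberTheory.Transcendental.GaGm

namespace Summit.ABC.StewartYu.GenThreeStepOdd

open Summit.ABC.StewartYu.GenThreeInductionOdd
open Summit.ABC.StewartYu.GenThreeStepTwo (logHeight₁_prod_zpow_le one_le_weightedNorm le_prod_of_one_le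
  prod_erase_le_prod log_max_three_le)

variable {p n r : ℕ}

/-! ### The step generators -/

/-- **The generators of Matveev's step at odd `p`, with every shape hypothesis of the internal statement
discharged.**  From the exit-C datum of the zero estimate (`H`, a `ℤ`-basis `M` of `H.chars`,
`b ∈ span_ℚ M`) over rational `p`-adic units `αⱼ` (independent, signed `2`-Kummer, `h(αⱼ) ≤ Vⱼ`, `1 ≤ Vⱼ`),
there are a re-based basis `Z` of `Φ`, generators `θᵢ = ∏ⱼ αⱼ^{Zᵢⱼ}`, weights `Aᵢ = ∑ⱼ Vⱼ|Zᵢⱼ|`, exponents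
`m ≠ 0` and `m₀ ≠ 0` with: `θᵢ` units, independence, signed `2`-Kummer, `h(θᵢ) ≤ Aᵢ`, `1 ≤ Aᵢ`,
`∏ θᵢ^{mᵢ} = (∏ αⱼ^{bⱼ})^{m₀}`, `∏ Aᵢ ≤ (r!)²nʳ·|det M_κ|·∏ V_κ` (maximal non-singular weighted minor `κ`),
`|m₀|·∏ V_κ′ ≤ ∏ Aᵢ`, `|mⱼ|·∏ V_κ′ ≤ (∑ V_κ′|b_κ′|)·∏_{i≠j} Aᵢ`.
[cite: Nesterenko2003, Prop 2.6 (2.9)–(2.13)] -/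
theorem exists_step_generators [Fact p.Prime] (hr : 0 < r)
    (α : Fin n → ℚ) (hα : ∀ j, α j ≠ 0 ∧ padicValRat p (α j) = 0)
    (hind : ∀ μ : Fin n → ℤ, ∏ j, α j ^ μ j = 1 → μ = 0)
    (hK : ∀ κ : Fin n → ℤ, (∃ γ : ℚ, ∏ j, α j ^ κ j = γ ^ 2 ∨ ∏ j, α j ^ κ j = -γ ^ 2) →
      ∀ j, (2 : ℤ) ∣ κ j)
    (V : Fin n → ℝ) (hV : ∀ j, Height.logHeight₁ (α j) ≤ V j) (hV1 : ∀ j, 1 ≤ V j)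
    (b : Fin n → ℤ) (hb : b ≠ 0)
    (H : ConnAlgSubgroup n) (M : Fin r → Fin n → ℤ) (hM : LinearIndependent ℤ M)
    (hchars : H.chars = AddSubgroup.closure (Set.range M))
    (hbM : (fun k => (b k : ℚ)) ∈ Submodule.span ℚ (Set.range fun i => fun k => (M i k : ℚ))) :
    ∃ (Z : Fin r → Fin n → ℤ) (κ κ' : Fin r → Fin n) (θ : Fin r → ℚ) (A : Fin r → ℝ)
      (m : Fin r → ℤ) (m₀ : ℤ),
      (∀ i, θ i = ∏ j, α j ^ Z i j) ∧ (∀ i, A i = ∑ j, V j * |(Z i j : ℝ)|) ∧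
      LinearIndependent ℤ Z ∧ Submodule.span ℤ (Set.range Z) = Submodule.span ℤ (Set.range M) ∧
      (∀ i, θ i ≠ 0 ∧ padicValRat p (θ i) = 0) ∧
      (∀ μ : Fin r → ℤ, ∏ i, θ i ^ μ i = 1 → μ = 0) ∧
      (∀ c : Fin r → ℤ, (∃ γ : ℚ, ∏ i, θ i ^ c i = γ ^ 2 ∨ ∏ i, θ i ^ c i = -γ ^ 2) →
        ∀ i, (2 : ℤ) ∣ c i) ∧
      (∀ i, Height.logHeight₁ (θ i) ≤ A i) ∧ (∀ i, 1 ≤ A i) ∧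
      m ≠ 0 ∧ m₀ ≠ 0 ∧ ∏ i, θ i ^ m i = (∏ j, α j ^ b j) ^ m₀ ∧
      Function.Injective κ ∧ (Matrix.of fun i j => (M j (κ i) : ℝ)).det ≠ 0 ∧
      (∀ κ₁ : Fin r → Fin n,
        |(Matrix.of fun i j => (M j (κ₁ i) : ℝ)).det| * ∏ i, V (κ₁ i) ≤
          |(Matrix.of fun i j => (M j (κ i) : ℝ)).det| * ∏ i, V (κ i)) ∧
      ∏ i, A i ≤ ((r.factorial : ℝ)) ^ 2 * (n : ℝ) ^ r *
          (|(Matrix.of fun i j => (M j (κ i) : ℝ)).det| * ∏ i, V (κ i)) ∧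
      Function.Injective κ' ∧ (|m₀| : ℝ) * ∏ i, V (κ' i) ≤ ∏ i, A i ∧
      (∀ j, (|m j| : ℝ) * ∏ i, V (κ' i) ≤
        (∑ i, V (κ' i) * |(b (κ' i) : ℝ)|) * ∏ i ∈ univ.erase j, A i) := by
  classical
  have hα0 : ∀ j, α j ≠ 0 := fun j => (hα j).1
  have hV0 : ∀ j, 0 < V j := fun j => by linarith [hV1 j]
  -- the unsigned Kummer condition (left disjunct) feeds `exists_matveev_step_data`
  have hK2 : ∀ φ : Fin n → ℤ, (∃ γ : ℚ, ∏ j, α j ^ φ j = γ ^ 2) → ∀ j, (2 : ℤ) ∣ φ j :=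
    fun φ ⟨γ, hγ⟩ => hK φ ⟨γ, Or.inl hγ⟩
  obtain ⟨Z, κ, m₀, mm, κ', hZli, hZspan, hκ, hdet, hmax, hprod, hκ', hm₀, hrel, hm₀le, hmle, hθK⟩ :=
    Summit.ABC.StewartYu.MatveevStepData.exists_matveev_step_data (K := ℚ) 2 (by norm_num) hr hV0 α hα0
      hind hK2 H M hM hchars b hbM
  set θ : Fin r → ℚ := fun i => ∏ j, α j ^ Z i j with hθdef
  set A : Fin r → ℝ := fun i => ∑ j, V j * |(Z i j : ℝ)| with hAdef
  have hθ : ∀ i, θ i = ∏ j, α j ^ Z i j := fun i => rfl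
  obtain ⟨hindθ, -⟩ := hθK θ hθ
  -- the SIGNED Kummer condition of the new generators: `span Z = span M` is `2`-saturated
  have hsat : ∀ v : Fin n → ℤ, (2 : ℤ) • v ∈ Submodule.span ℤ (Set.range Z) →
      v ∈ Submodule.span ℤ (Set.range Z) := by
    intro v hv
    rw [hZspan] at hv ⊢
    exact Summit.ABC.StewartYu.KummerBasisChange.qSaturated_span_of_chars H M hchars (by norm_num) v hv
  have hKθ := Summit.ABC.StewartYu.KummerBasisChange.kummerPM_basisChange 2 α hα0 hK Z hZli
    (by exact_mod_cast hsat) θ hθ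
  -- rows of `Z` are nonzero
  have hZne : ∀ i, Z i ≠ 0 := fun i => hZli.ne_zero i
  -- the relation `∏ θ^m = (∏ α^b)^{m₀}`
  have hrelθ : ∏ i, θ i ^ mm i = (∏ j, α j ^ b j) ^ m₀ := by
    rw [Summit.ABC.StewartYu.KummerBasisChange.prod_zpow_basisChange α hα0 Z θ hθ mm, ← Finset.prod_zpow]
    refine Finset.prod_congr rfl fun j _ => ?_
    rw [← zpow_mul, mul_comm (b j) m₀, hrel j]
  -- `m ≠ 0`
  have hmm : mm ≠ 0 := by
    intro h0
    apply hb
    funext k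
    have h1 := hrel k
    rw [h0] at h1
    simp only [Pi.zero_apply, zero_mul, Finset.sum_const_zero, mul_eq_zero] at h1
    rcases h1 with h1 | h1
    · exact absurd h1 hm₀
    · simpa using h1
  refine ⟨Z, κ, κ', θ, A, mm, m₀, hθ, fun i => rfl, hZli, hZspan, ?_, hindθ, hKθ, ?_, ?_, hmm, hm₀, hrelθ,
    hκ, hdet, hmax, hprod, hκ', hm₀le, hmle⟩
  · intro i
    exact unit_prod_zpow α hα (Z i)
  · intro i
    exact logHeight₁_prod_zpow_le α V hV (Z i)
  · intro i
    exact one_le_weightedNorm V hV1 (Z i) (hZne i)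

/-! ### Closing the step against the record's (5.22) line -/

/-- **Matveev's step at odd `p` closed against ONE numeric line.**  In the situation of
`exists_step_generators` with `r < n`, `Vⱼ ≤ Vmax`, `log max(3,|bⱼ|) ≤ W`, `1 ≤ W`, `0 ≤ C r`: if for EVERY
injective `κ` with `det M_κ ≠ 0` the record's inequality
`C(r)·P·(W + log 3 + log n + log Vmax + log P + log p + log 2P) ≤ C(n)·∏V·(W + log p + log 2Vmax)`,
`P = (r!)²nʳ·|det M_κ|·∏ V_κ`, holds, then `GenThreeInductionOdd.StepOdd C p n α b V Vmax W`.
(Choices: `A′max := P`, `W′ := W + log 3 + log n + log Vmax + log P`; `|mⱼ| ≤ n·Vmax·e^W·P`.)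
[cite: Nesterenko2003, §5.2 (5.22)] -/
theorem stepOdd_of_exitC [Fact p.Prime] {C : ℕ → ℝ} (hr : 0 < r) (hrn : r < n) (hCr : 0 ≤ C r)
    (α : Fin n → ℚ) (hα : ∀ j, α j ≠ 0 ∧ padicValRat p (α j) = 0)
    (hind : ∀ μ : Fin n → ℤ, ∏ j, α j ^ μ j = 1 → μ = 0)
    (hK : ∀ κ : Fin n → ℤ, (∃ γ : ℚ, ∏ j, α j ^ κ j = γ ^ 2 ∨ ∏ j, α j ^ κ j = -γ ^ 2) →
      ∀ j, (2 : ℤ) ∣ κ j)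
    (V : Fin n → ℝ) (Vmax W : ℝ) (hV : ∀ j, Height.logHeight₁ (α j) ≤ V j) (hV1 : ∀ j, 1 ≤ V j)
    (hVmax : ∀ j, V j ≤ Vmax)
    (b : Fin n → ℤ) (hb : b ≠ 0) (hW : ∀ j, Real.log (max 3 (|b j| : ℝ)) ≤ W) (hW1 : 1 ≤ W)
    (H : ConnAlgSubgroup n) (M : Fin r → Fin n → ℤ) (hM : LinearIndependent ℤ M)
    (hchars : H.chars = AddSubgroup.closure (Set.range M))
    (hbM : (fun k => (b k : ℚ)) ∈ Submodule.span ℚ (Set.range fun i => fun k => (M i k : ℚ)))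
    (hcost : ∀ κ : Fin r → Fin n, Function.Injective κ →
      (Matrix.of fun i j => (M j (κ i) : ℝ)).det ≠ 0 →
      C r * (((r.factorial : ℝ)) ^ 2 * (n : ℝ) ^ r *
              (|(Matrix.of fun i j => (M j (κ i) : ℝ)).det| * ∏ i, V (κ i))) *
          (W + Real.log 3 + Real.log n + Real.log Vmax +
            Real.log (((r.factorial : ℝ)) ^ 2 * (n : ℝ) ^ r *
              (|(Matrix.of fun i j => (M j (κ i) : ℝ)).det| * ∏ i, V (κ i))) +
            Real.log p +
            Real.log (2 * (((r.factorial : ℝ)) ^ 2 * (n : ℝ) ^ r *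
              (|(Matrix.of fun i j => (M j (κ i) : ℝ)).det| * ∏ i, V (κ i))))) ≤
        C n * (∏ j, V j) * (W + Real.log p + Real.log (2 * Vmax))) :
    StepOdd C p n α b V Vmax W := by
  classical
  obtain ⟨Z, κ, κ', θ, A, m, m₀, hθ, hA, _hZli, _hZspan, hθu, hindθ, hKθ, hhA, hA1, _hm, hm₀, hrel, hκ, hdet,
    _hmax, hprod, hκ', hm₀le, hmle⟩ :=
    exists_step_generators hr α hα hind hK V hV hV1 b hb H M hM hchars hbM
  -- the quantity `P`
  set P : ℝ := ((r.factorial : ℝ)) ^ 2 * (n : ℝ) ^ r *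
      (|(Matrix.of fun i j => (M j (κ i) : ℝ)).det| * ∏ i, V (κ i)) with hPdef
  have hn1 : (1 : ℝ) ≤ n := by
    have : 1 ≤ n := by omega
    exact_mod_cast this
  have hVmax1 : 1 ≤ Vmax := by
    have j : Fin n := ⟨0, by omega⟩
    exact (hV1 j).trans (hVmax j)
  -- `1 ≤ ∏ A ≤ P`
  have hprodA1 : 1 ≤ ∏ i, A i := Finset.one_le_prod fun i _ => hA1 i
  have hP1 : 1 ≤ P := hprodA1.trans hprod
  have hP0 : 0 < P := by linarith
  -- `A i ≤ P`
  have hAleP : ∀ i, A i ≤ P := fun i => (le_prod_of_one_le hA1 i).trans hprod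
  -- `∏ V_κ' ≥ 1`
  have hVκ'1 : 1 ≤ ∏ i, V (κ' i) := Finset.one_le_prod fun i _ => hV1 _
  -- `|b j| ≤ e^W`
  have hbW : ∀ j, (|b j| : ℝ) ≤ Real.exp W := by
    intro j
    have h1 : Real.log (max 3 (|b j| : ℝ)) ≤ W := hW j
    have h3 : (0 : ℝ) < max 3 (|b j| : ℝ) := lt_max_of_lt_left (by norm_num)
    have h2 : max 3 (|b j| : ℝ) ≤ Real.exp W := by
      calc max 3 (|b j| : ℝ) = Real.exp (Real.log (max 3 (|b j| : ℝ))) := (Real.exp_log h3).symm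
        _ ≤ Real.exp W := Real.exp_le_exp.mpr h1
    exact (le_max_right _ _).trans h2
  -- `∑ V_κ' |b_κ'| ≤ n · Vmax · e^W`
  have hsum : ∑ i, V (κ' i) * |(b (κ' i) : ℝ)| ≤ (n : ℝ) * Vmax * Real.exp W := by
    have h1 : ∀ i, V (κ' i) * |(b (κ' i) : ℝ)| ≤ Vmax * Real.exp W := by
      intro i
      exact mul_le_mul (hVmax _) (hbW _) (abs_nonneg _) (by linarith)
    calc ∑ i, V (κ' i) * |(b (κ' i) : ℝ)| ≤ ∑ _i : Fin r, Vmax * Real.exp W :=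
          Finset.sum_le_sum fun i _ => h1 i
      _ = (r : ℝ) * (Vmax * Real.exp W) := by
          rw [Finset.sum_const, Finset.card_univ, Fintype.card_fin, nsmul_eq_mul]
      _ ≤ (n : ℝ) * (Vmax * Real.exp W) := by
          have : (r : ℝ) ≤ n := by exact_mod_cast hrn.le
          exact mul_le_mul_of_nonneg_right this (by positivity)
      _ = (n : ℝ) * Vmax * Real.exp W := by ring
  -- `|m j| ≤ n · Vmax · e^W · P`
  have hmj : ∀ j, (|m j| : ℝ) ≤ (n : ℝ) * Vmax * Real.exp W * P := by
    intro j
    have h1 := hmle j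
    have h2 : ∏ i ∈ univ.erase j, A i ≤ P := (prod_erase_le_prod hA1 j).trans hprod
    have h3 : (|m j| : ℝ) ≤ (|m j| : ℝ) * ∏ i, V (κ' i) := by
      calc (|m j| : ℝ) = (|m j| : ℝ) * 1 := by ring
        _ ≤ (|m j| : ℝ) * ∏ i, V (κ' i) := mul_le_mul_of_nonneg_left hVκ'1 (abs_nonneg _)
    calc (|m j| : ℝ) ≤ (|m j| : ℝ) * ∏ i, V (κ' i) := h3
      _ ≤ (∑ i, V (κ' i) * |(b (κ' i) : ℝ)|) * ∏ i ∈ univ.erase j, A i := h1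
      _ ≤ ((n : ℝ) * Vmax * Real.exp W) * P :=
          mul_le_mul hsum h2 (Finset.prod_nonneg fun i _ => by linarith [hA1 i]) (by positivity)
      _ = (n : ℝ) * Vmax * Real.exp W * P := by ring
  -- `W' := W + log 3 + log n + log Vmax + log P`
  set W' : ℝ := W + Real.log 3 + Real.log n + Real.log Vmax + Real.log P with hW'def
  have hlog3 : 0 ≤ Real.log 3 := Real.log_nonneg (by norm_num)
  have hlogn : 0 ≤ Real.log n := Real.log_nonneg hn1
  have hlogV : 0 ≤ Real.log Vmax := Real.log_nonneg hVmax1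
  have hlogP : 0 ≤ Real.log P := Real.log_nonneg hP1
  have hW1' : 1 ≤ W' := by rw [hW'def]; linarith
  have hWm : ∀ j, Real.log (max 3 (|m j| : ℝ)) ≤ W' := by
    intro j
    have h1 := log_max_three_le (|(m j : ℝ)|)
    have hQ : (1 : ℝ) ≤ (n : ℝ) * Vmax * Real.exp W * P := by
      have hE : 1 ≤ Real.exp W := by
        have := Real.add_one_le_exp W; linarith
      have h12 : (1 : ℝ) ≤ (n : ℝ) * Vmax := by nlinarith
      have h123 : (1 : ℝ) ≤ (n : ℝ) * Vmax * Real.exp W := by nlinarith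
      nlinarith
    have h2 : max 1 (|(m j : ℝ)|) ≤ (n : ℝ) * Vmax * Real.exp W * P := max_le hQ (hmj j)
    have h3 : Real.log (max 1 (|(m j : ℝ)|)) ≤ Real.log ((n : ℝ) * Vmax * Real.exp W * P) :=
      Real.log_le_log (lt_max_of_lt_left one_pos) h2
    have h4 : Real.log ((n : ℝ) * Vmax * Real.exp W * P) =
        Real.log n + Real.log Vmax + W + Real.log P := by
      rw [Real.log_mul (by positivity) (ne_of_gt hP0), Real.log_mul (by positivity) (Real.exp_ne_zero W),
        Real.log_mul (by positivity) (by positivity), Real.log_exp]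
    rw [hW'def]
    linarith
  -- the cost inequality with `A'max := P`
  have hcostκ := hcost κ hκ hdet
  have hlogp : 0 ≤ Real.log p := Real.log_natCast_nonneg p
  have hfinal : C r * (∏ i, A i) * (W' + Real.log p + Real.log (2 * P)) ≤
      C n * (∏ j, V j) * (W + Real.log p + Real.log (2 * Vmax)) := by
    have hlog2P : 0 ≤ Real.log (2 * P) := Real.log_nonneg (by linarith)
    have hWsum : 0 ≤ W' + Real.log p + Real.log (2 * P) := by linarith
    calc C r * (∏ i, A i) * (W' + Real.log p + Real.log (2 * P))
        ≤ C r * P * (W' + Real.log p + Real.log (2 * P)) := by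
          have : C r * (∏ i, A i) ≤ C r * P := mul_le_mul_of_nonneg_left hprod hCr
          exact mul_le_mul_of_nonneg_right this hWsum
      _ = C r * P * (W + Real.log 3 + Real.log n + Real.log Vmax + Real.log P + Real.log p +
            Real.log (2 * P)) := by
          rw [hW'def]
      _ ≤ C n * (∏ j, V j) * (W + Real.log p + Real.log (2 * Vmax)) := hcostκ
  exact stepOdd_of_pow_eq hα hind hb hrn θ m A P W' hθu hindθ hKθ hhA hA1 hAleP hWm hW1' m₀ hm₀ hrel
    hfinal

end Summit.ABC.StewartYu.GenThreeStepOdd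

end
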